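import Summits.Ventures.CertifiedManyBodySolver.Downfold.EmeryFermiFillingTl1223OPSubs
import Summits.Ventures.CertifiedManyBodySolver.Downfold.EmeryFermiFillingLa214
import Summits.Ventures.CertifiedManyBodySolver.Downfold.EmeryBoxesKSlicesO
import HarnessLib

/-!
# TlBa₂Ca₂Cu₃O₉ OUTER plane (box #314 Tl-1223, (K) source rows): the typed 3BE one-body box `emeryBoxTl1223OPK11Src` ⇒ a CERTIFIED window for the object-E Fermi-surface `t′/t` of the σ three-band
# model at the box's own hole count — and a certified MODEL-FORM CEILING against the E row of record

Venture CertifiedManyBodySolver, cell `pub/hubbard-downfold` (stage S1, HUMAN RULINGS D-0096/D-0098), seat hubbard-downfold-mod-4 (technique B = band level);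
namespace `Summit.Ventures.CertifiedManyBodySolver.Downfold.Emery`. Everything PROVED; numerics decided by the kernel (`EmeryFermiFillingTl1223OPSubs`).
Same device as `EmeryFermiFillingLa214` / `EmeryFermiFillingHg1201` / `EmeryFermiFillingLSCO`.

THE STATEMENT (`emeryBoxTl1223OPK11Src_fsRatio_window`). For every parameter vector of `emeryBoxTl1223OPK11Src` (`EmeryBoxesKSlicesO`: Tl-1223 OUTER-plane ONE-BODY rows (DFT-level Δ_pd sub-range), n_H ∈ [1.14, 1.18]: Δ_pd [1.47, 2.24] × t_pd [1.17, 1.38] × t_pp [0.61, 0.73] × t_pp′ [0.14, 0.18]; n_H ∈ [1.14, 1.18])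
and every Fermi energy ε with `abFilling(ε) = (2 − n_H)/2` (the σ-model antibonding band holds the box's own electrons):
**`t′/t = fsRatio(ε) ∈ [-0.3346, -0.2531]`** and **ε ∈ [1.22, 2.24]** (box units, eV above ε_d).

READING (certified): the box's object-E row of record `t′/t (E) ∈ [−0.486, −0.373]` (box l.28) vs the σ-model Fermi-surface window [-0.3346, -0.2531] on the whole one-body box at its own hole count —
see the corollary below: DISJOINT ⇒ certified MODEL-FORM CEILING; INSIDE ⇒ consistency; partial overlap ⇒ a cut by sub-box (table in the Subs file). Trilayer note: the
INNER plane has no apical oxygen; comparing its gap with the outer plane's tests how much of INFL-3to1-B(t′/t of E) is apical vs in-plane/reservoir.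

WHAT THIS IS NOT: not a statement that the material's parameters ARE in the box (SCREENING-GRADE provenance); the theorem certifies the REDUCTION STEP
of the σ d–p_x–p_y(+t_pp, t_pp′) model only; not the interaction (`U`) reduction; no phase sentence. Sources: [HybertsenSchluterChristensen1989, Eq. (1)];
[AndersenEtAl1995, §6]; [PavariniEtAl2001, Eq. (1)].
-/

noncomputable section

namespace Summit.Ventures.CertifiedManyBodySolver.Downfold.Emery

open Real Set
open Summit.Ventures.CertifiedManyBodySolver.Downfold

/-- Per-spin antibonding filling from the box's hole count: `n_H ∈ [57/50, 59/50] ⇒ (2 − n_H)/2 ∈ [41/100, 43/100]`. [folklore] -/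
theorem abFilling_rowTl1223OP_of_nHoles {nH f : ℝ} (h1 : (57 / 50 : ℝ) ≤ nH) (h2 : nH ≤ (59 / 50 : ℝ)) (hf : f = (2 - nH) / 2) :
    f ∈ Set.Icc (41 / 100 : ℝ) (43 / 100 : ℝ) := by
  rw [hf]; constructor <;> linarith

/-- **TlBa₂Ca₂Cu₃O₉ OUTER plane (box #314 Tl-1223, (K) source rows): 3BE box ⇒ object-E `t′/t` window (raw coordinates)** at per-spin filling ∈ [0.41, 0.43]:
`ε ∈ [1.22, 2.24]` and `t′/t ∈ [-0.3346, -0.2531]`. [folklore] -/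
theorem tl1223OPBox_fsRatio_window {Δ tpd tpp c ε : ℝ} (hΔ : Δ ∈ Set.Icc (147 / 100 : ℝ) (56 / 25 : ℝ))
    (ha : tpd ∈ Set.Icc (117 / 100 : ℝ) (69 / 50 : ℝ)) (hb : tpp ∈ Set.Icc (61 / 100 : ℝ) (73 / 100 : ℝ))
    (hc : c ∈ Set.Icc (7 / 50 : ℝ) (9 / 50 : ℝ))
    (hν : abFilling Δ tpd tpp c ε ∈ Set.Icc (41 / 100 : ℝ) (43 / 100 : ℝ)) :
    ε ∈ Set.Icc (61 / 50 : ℝ) (56 / 25 : ℝ) ∧ fsRatio Δ tpd tpp c ε ∈ Set.Icc (-(1673 / 5000 : ℝ)) (-(2531 / 10000 : ℝ)) := by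
  have hΔ' := hΔ
  constructor
  · clear hΔ
    rcases mem_Icc_split hΔ' (371 / 200 : ℝ) with hΔ' | hΔ'
    · rcases mem_Icc_split hΔ' (133 / 80 : ℝ) with hΔ' | hΔ'
      · rcases mem_Icc_split ha (51 / 40 : ℝ) with ha' | ha'
        · have h := (tl1223OPSub_0_0 hΔ' ha' hb hc hν).1
          exact ⟨le_trans (by norm_num) h.1, h.2.trans (by norm_num)⟩
        · have h := (tl1223OPSub_0_1 hΔ' ha' hb hc hν).1
          exact ⟨le_trans (by norm_num) h.1, h.2.trans (by norm_num)⟩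
      · rcases mem_Icc_split ha (51 / 40 : ℝ) with ha' | ha'
        · have h := (tl1223OPSub_1_0 hΔ' ha' hb hc hν).1
          exact ⟨le_trans (by norm_num) h.1, h.2.trans (by norm_num)⟩
        · have h := (tl1223OPSub_1_1 hΔ' ha' hb hc hν).1
          exact ⟨le_trans (by norm_num) h.1, h.2.trans (by norm_num)⟩
    · rcases mem_Icc_split hΔ' (819 / 400 : ℝ) with hΔ' | hΔ'
      · rcases mem_Icc_split ha (51 / 40 : ℝ) with ha' | ha'
        · have h := (tl1223OPSub_2_0 hΔ' ha' hb hc hν).1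
          exact ⟨le_trans (by norm_num) h.1, h.2.trans (by norm_num)⟩
        · have h := (tl1223OPSub_2_1 hΔ' ha' hb hc hν).1
          exact ⟨le_trans (by norm_num) h.1, h.2.trans (by norm_num)⟩
      · rcases mem_Icc_split ha (51 / 40 : ℝ) with ha' | ha'
        · have h := (tl1223OPSub_3_0 hΔ' ha' hb hc hν).1
          exact ⟨le_trans (by norm_num) h.1, h.2.trans (by norm_num)⟩
        · have h := (tl1223OPSub_3_1 hΔ' ha' hb hc hν).1
          exact ⟨le_trans (by norm_num) h.1, h.2.trans (by norm_num)⟩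
  · clear hΔ
    rcases mem_Icc_split hΔ' (371 / 200 : ℝ) with hΔ' | hΔ'
    · rcases mem_Icc_split hΔ' (133 / 80 : ℝ) with hΔ' | hΔ'
      · rcases mem_Icc_split ha (51 / 40 : ℝ) with ha' | ha'
        · have h := (tl1223OPSub_0_0 hΔ' ha' hb hc hν).2
          exact ⟨le_trans (by norm_num) h.1, h.2.trans (by norm_num)⟩
        · have h := (tl1223OPSub_0_1 hΔ' ha' hb hc hν).2
          exact ⟨le_trans (by norm_num) h.1, h.2.trans (by norm_num)⟩
      · rcases mem_Icc_split ha (51 / 40 : ℝ) with ha' | ha'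
        · have h := (tl1223OPSub_1_0 hΔ' ha' hb hc hν).2
          exact ⟨le_trans (by norm_num) h.1, h.2.trans (by norm_num)⟩
        · have h := (tl1223OPSub_1_1 hΔ' ha' hb hc hν).2
          exact ⟨le_trans (by norm_num) h.1, h.2.trans (by norm_num)⟩
    · rcases mem_Icc_split hΔ' (819 / 400 : ℝ) with hΔ' | hΔ'
      · rcases mem_Icc_split ha (51 / 40 : ℝ) with ha' | ha'
        · have h := (tl1223OPSub_2_0 hΔ' ha' hb hc hν).2
          exact ⟨le_trans (by norm_num) h.1, h.2.trans (by norm_num)⟩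
        · have h := (tl1223OPSub_2_1 hΔ' ha' hb hc hν).2
          exact ⟨le_trans (by norm_num) h.1, h.2.trans (by norm_num)⟩
      · rcases mem_Icc_split ha (51 / 40 : ℝ) with ha' | ha'
        · have h := (tl1223OPSub_3_0 hΔ' ha' hb hc hν).2
          exact ⟨le_trans (by norm_num) h.1, h.2.trans (by norm_num)⟩
        · have h := (tl1223OPSub_3_1 hΔ' ha' hb hc hν).2
          exact ⟨le_trans (by norm_num) h.1, h.2.trans (by norm_num)⟩

/-- The five rows of `emeryBoxTl1223OPK11Src` this file reads. [folklore] -/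
theorem emeryBoxTl1223OPK11Src_mem_rows {p : EmeryCoord → ℝ} (hp : emeryBoxTl1223OPK11Src.Mem p) :
    p .DeltaPd ∈ Set.Icc (147 / 100 : ℝ) (56 / 25 : ℝ) ∧ p .tpd ∈ Set.Icc (117 / 100 : ℝ) (69 / 50 : ℝ) ∧
      p .tpp ∈ Set.Icc (61 / 100 : ℝ) (73 / 100 : ℝ) ∧ p .tppP ∈ Set.Icc (7 / 50 : ℝ) (9 / 50 : ℝ) ∧
      p .nHoles ∈ Set.Icc (57 / 50 : ℝ) (59 / 50 : ℝ) := by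
  have hΔ := (Entry.mem_ofEnds_iff _ _ _ _ _).1 (hp .DeltaPd tl1223OPK11Emery_DeltaKS rfl)
  have ha := (Entry.mem_ofEnds_iff _ _ _ _ _).1 (hp .tpd tl1223OPK11Emery_tpd rfl)
  have hb := (Entry.mem_ofEnds_iff _ _ _ _ _).1 (hp .tpp tl1223OPK11Emery_tpp rfl)
  have hc := (Entry.mem_ofEnds_iff _ _ _ _ _).1 (hp .tppP tl1223OPK11Emery_tppP rfl)
  have hn := (Entry.mem_ofEnds_iff _ _ _ _ _).1 (hp .nHoles tl1223OPK11Emery_nH rfl)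
  push_cast at hΔ ha hb hc hn
  exact ⟨⟨hΔ.1, hΔ.2⟩, ⟨ha.1, ha.2⟩, ⟨hb.1, hb.2⟩, ⟨hc.1, hc.2⟩, ⟨hn.1, hn.2⟩⟩

/-- **THE WORD ON THE TYPED BOX `emeryBoxTl1223OPK11Src`**: at every parameter vector and every Fermi energy at which the σ-model antibonding band holds the
box's own electron count, `ε ∈ [1.22, 2.24]` and the exact σ-model Fermi-surface `t′/t ∈ [-0.3346, -0.2531]`.
[cite: HybertsenSchluterChristensen1989, Eq. (1) (three-band d–p model)] -/
theorem emeryBoxTl1223OPK11Src_fsRatio_window :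
    HoldsOn (fun p : EmeryCoord → ℝ => ∀ ε : ℝ,
      abFilling (p .DeltaPd) (p .tpd) (p .tpp) (p .tppP) ε = (2 - p .nHoles) / 2 →
      ε ∈ Set.Icc (61 / 50 : ℝ) (56 / 25 : ℝ) ∧
      fsRatio (p .DeltaPd) (p .tpd) (p .tpp) (p .tppP) ε ∈ Set.Icc (-(1673 / 5000 : ℝ)) (-(2531 / 10000 : ℝ))) emeryBoxTl1223OPK11Src := by
  intro p hp ε hf
  obtain ⟨hΔ, ha, hb, hc, hn⟩ := emeryBoxTl1223OPK11Src_mem_rows hp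
  exact tl1223OPBox_fsRatio_window hΔ ha hb hc (abFilling_rowTl1223OP_of_nHoles hn.1 hn.2 hf)

/-- **MODEL-FORM CEILING, CERTIFIED**: on the whole box the σ-model Fermi-surface `t′/t` window [-0.3346, -0.2531] is DISJOINT from the object-E
row of record `[-0.486, -0.373]` (router/BOXES/TlBa2Ca2Cu3O9.md l.28 «tp/t (E) @Cu-OP [−0.486, −0.373]») — the d–p_x–p_y(+t_pp, t_pp′) model cannot produce this material's one-band Fermi-surface
shape anywhere in its 3BE box. [folklore] -/
theorem emeryBoxTl1223OPK11Src_fsRatio_not_objectE :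
    HoldsOn (fun p : EmeryCoord → ℝ => ∀ ε : ℝ,
      abFilling (p .DeltaPd) (p .tpd) (p .tpp) (p .tppP) ε = (2 - p .nHoles) / 2 →
      fsRatio (p .DeltaPd) (p .tpd) (p .tpp) (p .tppP) ε ∉ Set.Icc (-(243 / 500 : ℝ)) (-(373 / 1000 : ℝ))) emeryBoxTl1223OPK11Src := by
  intro p hp ε hf hmem
  have h := (emeryBoxTl1223OPK11Src_fsRatio_window p hp ε hf).2
  have : (-(373 / 1000 : ℝ)) < (-(1673 / 5000 : ℝ)) := by norm_num
  linarith [h.1, hmem.2]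

end Summit.Ventures.CertifiedManyBodySolver.Downfold.Emery
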